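import Summits.PneNP.PneNP.Theses.OneSlice
import Summits.PneNP.PneNP.Theorems.OneSliceSliceTargetTransfer
import Summits.PneNP.PneNP.Theorems.OneSliceSliceTargetSliceTouch
import Summits.PneNP.PneNP.Theorems.OneSliceSliceTargetFibreMin
import Summits.PneNP.PneNP.Theorems.OneSliceSliceTargetFibreCliqueLower
import Summits.PneNP.PneNP.Theorems.OneSliceSliceTargetFibreCliqueUpper
import Summits.PneNP.PneNP.Theorems.OneSliceSliceTargetQuarter

/-!
# `SliceTarget` (stmt-PneNP-2832), line `Sketch-ideator3-r1` — what the line PROVES about X, as tree theorems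

X = `Summit.PneNP.PneNP.Theses.OneSlice.SliceTarget` = `∀ c, X(c)`, with X(c) = "∃ k ≥ 3, δ > 0: eventually, on every central
slice `j` of the critical window, every `{∧₂,∨₂}`-circuit `C` with `#{x ∈ slice_j : C(x) ≠ CLIQUE_k(x)} ≤ δ·#slice_j` has more than
`n^c` gates" (`SliceTargetAt c`, definitionally: `sliceTarget_iff_forall`). This file assembles the landed stubs of the line into:

* `sliceTargetAt_le_one` — **X(0) and X(1) hold unconditionally** (at `k = 4`): the locality floor `sliceLB_of_locality`
  (Theorems/OneSliceSliceTargetTransfer.lean) fed by T1 `stub_sliceTouch`, T2 `stub_fibreMin`, T3 `stub_fibreCliqueLower`,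
  T4 `stub_fibreCliqueUpper` — a `{∧₂,∨₂}`-circuit with `≤ n` gates reads `≤ 2n + 1 = o(m_4(n))` edge slots, and on every fibre of
  its read set both truth values of `CLIQUE_4` have constant density.
* `sliceTarget_of_sliceHardQuarter` — **the named reduction**: X follows from T9 `SliceHardQuarter` = X(≥2) restricted to circuits in
  the size window `C(n,2) ≤ 4·size + 1` (lead -1's `sliceTargetFrom2_of_quarter`, Theorems/OneSliceSliceTargetQuarter.lean), and
  conversely (`sliceHardQuarter_of_sliceTarget`), so `sliceTarget_iff_sliceHardQuarter`: **the crux is equivalent to its residual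
  stub T9**. Everything the line could peel off X (exponents `c ≤ 1`; sizes below `C(n,2)/4` at every exponent) is peeled; what is
  left is X(≥2) itself on the window, an average-case lower bound on ONE slice where monotone = general up to the Berkowitz overhead.

Lead prover-line-stmt-PneNP-2832-c1-0 (continuation), 2026-08-16; composition of skeleton v8 (`Cruxes/SliceTarget/Lines/Sketch_ideator3_r1.lean`).
-/

set_option linter.dupNamespace false

namespace Summit.PneNP.PneNP.Cruxes.SliceTarget.Ideator3Line

open Literature.Computability.Complexity Finset Filter Classical
open scoped Topology
open Summit.PneNP.PneNP.Theorems.ConstantBand.Negative (Edge thr Central slice errSet)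

noncomputable section

/-- **X(0) and X(1), unconditionally.** For `c ≤ 1` there are `k ≥ 3` (namely `k = 4`) and `δ > 0` such that eventually, on every
central critical slice, every `δ`-accurate `{∧₂,∨₂}`-circuit for `CLIQUE_k` has more than `n^c` gates — the two lowest conjuncts of
the crux `SliceTarget`, by the locality floor. [folklore] -/
theorem sliceTargetAt_le_one : ∀ {c : ℕ}, c ≤ 1 →
    ∃ k : ℕ, 3 ≤ k ∧ ∃ δ : ℝ, 0 < δ ∧ ∀ᶠ n : ℕ in atTop, ∀ j : ℕ, Central k n j →
      ∀ C : Circuit (Edge n), C.IsOver monotoneBasis → (#(errSet n k j C) : ℝ) ≤ δ * #(slice n j) → n ^ c < C.size := by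
  intro c hc
  obtain ⟨δ, hδ, h⟩ := sliceLB_of_locality hc stub_sliceTouch stub_fibreMin stub_fibreCliqueLower stub_fibreCliqueUpper
  exact ⟨4, by norm_num, δ, hδ, h⟩

/-- **The named reduction X ⟸ T9.** If for every `c ≥ 2` some `k ≥ 3` and `δ > 0` make every `{∧₂,∨₂}`-circuit IN THE WINDOW
`C(n,2) ≤ 4·size + 1` that is `δ`-accurate for `CLIQUE_k` on a central critical slice have more than `n^c` gates (eventually, every
central `j`) — the registered stub T9 `stub_sliceHardQuarter` of line `Sketch-ideator3-r1` — then `SliceTarget` holds: `c ≤ 1` by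
`sliceTargetAt_le_one`, `c ≥ 2` by the quarter floor (`sliceTargetFrom2_of_quarter`). [folklore] -/
theorem sliceTarget_of_sliceHardQuarter
    (h₉ : ∀ c : ℕ, 2 ≤ c → ∃ k : ℕ, 3 ≤ k ∧ ∃ δ : ℝ, 0 < δ ∧ ∀ᶠ n : ℕ in atTop, ∀ j : ℕ, Central k n j →
      ∀ C : Circuit (Edge n), C.IsOver monotoneBasis → n.choose 2 ≤ 4 * C.size + 1 →
        (#(errSet n k j C) : ℝ) ≤ δ * #(slice n j) → n ^ c < C.size) :
    Summit.PneNP.PneNP.Theses.OneSlice.SliceTarget := by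
  intro c
  by_cases hc : c ≤ 1
  · exact sliceTargetAt_le_one hc
  · exact sliceTargetFrom2_of_quarter h₉ c (by omega)

/-- Conversely the crux gives T9 (restriction to the window). [folklore] -/
theorem sliceHardQuarter_of_sliceTarget (hX : Summit.PneNP.PneNP.Theses.OneSlice.SliceTarget) :
    ∀ c : ℕ, 2 ≤ c → ∃ k : ℕ, 3 ≤ k ∧ ∃ δ : ℝ, 0 < δ ∧ ∀ᶠ n : ℕ in atTop, ∀ j : ℕ, Central k n j →
      ∀ C : Circuit (Edge n), C.IsOver monotoneBasis → n.choose 2 ≤ 4 * C.size + 1 →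
        (#(errSet n k j C) : ℝ) ≤ δ * #(slice n j) → n ^ c < C.size :=
  quarter_of_sliceTargetFrom2 fun c _ => hX c

/-- **The crux IS its residual stub**: `SliceTarget ↔ T9`. [folklore] -/
theorem sliceTarget_iff_sliceHardQuarter :
    Summit.PneNP.PneNP.Theses.OneSlice.SliceTarget ↔
    ∀ c : ℕ, 2 ≤ c → ∃ k : ℕ, 3 ≤ k ∧ ∃ δ : ℝ, 0 < δ ∧ ∀ᶠ n : ℕ in atTop, ∀ j : ℕ, Central k n j →
      ∀ C : Circuit (Edge n), C.IsOver monotoneBasis → n.choose 2 ≤ 4 * C.size + 1 →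
        (#(errSet n k j C) : ℝ) ≤ δ * #(slice n j) → n ^ c < C.size :=
  ⟨sliceHardQuarter_of_sliceTarget, sliceTarget_of_sliceHardQuarter⟩

end

end Summit.PneNP.PneNP.Cruxes.SliceTarget.Ideator3Line
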